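import Summits.BirchSwinnertonDyer.Rank1Residual.X11a.SelmerCompanionSplitAtP
import Summits.BirchSwinnertonDyer.Rank1Residual.X11a.SelmerCompanionRankOnePartner
import HarnessLib

/-!
# Route (3e) SELMER COMPANION, XX: shape E — `E` SPLIT multiplicative at `p` with an anomalous good
# partner that is strict at `p` (class X11a = N7; cell `b2b-bsdres`, unit `b2b-bsdres-x11a`, gen 29)

HONEST FRAMING (run/shared/lean/b2b/bsd-rank1-residual/, verbatim in every file): the goal of the
cell is to DELETE the COMBINATION-SHAPED residual classes of the Birch–Swinnerton-Dyer formula for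
ALL analytic-rank `≤ 1` elliptic curves over `ℚ` — "full BSD formula for every rank `≤ 1` curve in
class `C`" assembled STRICTLY from published theorems — so that the rank-`≤ 1` remainder becomes
exactly the CONSTRUCTION-SHAPED classes, which are TYPED (missing-input `Prop`s), NOT attempted.
This is not "finishing BSD". CLASS-OWNERS.md: research routes; NO CLAIM BEYOND STATED CLASSES.
THEOREMS ONLY; nothing booked; no label moves. CONDITIONAL on the PUBLISHED binders GZK (`hGZK`),
Cassels–Tate (`hCT`), Tate uniformisation (`hU` = A40, `hU2` = A41), Tate's local Euler
characteristic (`hEP`, Milne *ADT* I Thm. 2.8), and on the per-pair finite data named.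

## What this file proves

The census of gen 28 (`HOME/b2b-bsdres-x11a/g28/SELMER-COMPANION-CENSUS-v4.md` §3) found that the
N7 cells out of reach at `p = 3` are dominated (52 of 75 cells at budget `27`; 9 leaf cells at
`p = 5`, budget `125`) by ONE pattern: `E` is SPLIT multiplicative at `p` itself, the closed partner
`A` is good at `p` — hence anomalous, kind (v) of file VIII does not apply, and the place was charged
`#𝓛_p(E) = p²` — and `A` has rank ONE (factor `p`). Files XVIII-b/c and XIX replace the charge `p²`
by the true comparison index `ι_p ≤ p` and remove the factor `#Sel^(p)(A)` when `A` is STRICT at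
`p`. Here: the count `natCard_selmerGroup_le_of_congr_of_le_off_insert_strict` (general `K`:
agreement off `T ∪ {v₀}`, an index bound `m` at `v₀`, strictness at `v₀` ⇒
`#Sel^(p)(E') ≤ m · ∏_{v∈T} #𝓛_v(E')`), its `ℚ`-form with the six kinds of file XII and `v₀ = (p)`
(`natCard_selmerGroup_le_of_six_kinds_strict_at_p_rat`), and the booking shape
`bsdp_of_selmerCompanion_strict_at_p_six_kinds`:

**`BSD(E,p)` for a rank-`0` pair `(E,p)` (`p` odd, `E[p]` irreducible, `p ∤ #Ш_an(E)`) from a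
`Γ_ℚ`-isomorphism `A[p] ≅ E[p]` with `E` multiplicative and `A` good at `p`, `A` strict at `p`
(`hstrict` of file XIX: no non-zero class of `Sel^(p)(A)` is at `p` the coboundary of a point `b`
with `σb - b` in the kernel of reduction; certificate for a closed rank-one partner: `g̃ ∉ pÃ(𝔽_p)`),
the other places of `S \ T` of the six kinds, and `p · ∏_{v∈T} #E(ℚ_v)[p]·#(ℤ_v/p) ≤ p` (i.e. no
further lossy place).** No hypothesis `BSD(A,p)`, no rank condition on `A`, no main conjecture, no
`μ`. Not a class theorem; nothing booked.

References: files I, XII, XIII, XVIII-b/c, XIX; [MazurRubin2004] §2.3; [GreenbergLNM1716] §2;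
[SilvermanATAEC1994] V 3.1, 5.2–5.4; [MilneADT2006] I Thm. 2.8; [Miller2011LMS] Def. 1.1;
HOME/b2b-bsdres-x11a/REPORT-g29.md.
-/

set_option autoImplicit false

noncomputable section

open scoped Classical NNReal

open WeierstrassCurve Literature.NumberTheory.EllipticCurves
  Literature.NumberTheory.GaloisRepresentations Field NumberField IsDedekindDomain
  Literature.NumberTheory.EllipticCurves.Rank1Residual
  Literature.NumberTheory.EllipticCurves.Rank1Residual.Typed

namespace Summit.BirchSwinnertonDyer.Rank1Residual.X11a.SelmerCompanion

section Main

variable {K : Type} [Field K] [NumberField K] (W W' : WeierstrassCurve K) [W.IsElliptic]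
  [W'.IsElliptic] {p : ℕ} [Fact p.Prime]

/-- **The count with a refined index and strictness at one place.** With `θ : E'[p] ≃ E[p]`, `p`
odd, `S`, `T ⊆ S` as in file I, a place `v₀ ∈ S \ T`, agreement of the local conditions along `θ`
off `T ∪ {v₀}`, a bound `ι_{v₀}(θ) ≤ m` for the comparison index at `v₀`, and strictness at `v₀`
(every class of `Sel^(p)(E)` in `θ_* 𝓢_{v₀}(E')` is zero):
`#Sel^(p)(E'/K) ≤ m · ∏_{v ∈ T} #𝓛_v(E')`. (File XIII with `∏_{v∈S} ι_v = ι_{v₀} · ∏_{v∈T} ι_v`.)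
[cite: MazurRubin2004, §2.3] -/
theorem natCard_selmerGroup_le_of_congr_of_le_off_insert_strict (hp2 : p ≠ 2)
    (θ : geomTorsion W' (p : ℤ) ≃+ geomTorsion W (p : ℤ))
    (hθ : ∀ (σ : absoluteGaloisGroup K) (P : geomTorsion W' (p : ℤ)), θ (σ • P) = σ • θ P)
    (S T : Finset (HeightOneSpectrum (𝓞 K))) {v₀ : HeightOneSpectrum (𝓞 K)} (hv₀S : v₀ ∈ S)
    (hv₀T : v₀ ∉ T) (hTS : T ⊆ S)
    (hS : ∀ v : HeightOneSpectrum (𝓞 K), v ∉ S →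
      W.HasGoodReductionAt v ∧ W'.HasGoodReductionAt v ∧ (p : 𝓞 K) ∉ v.asIdeal)
    (hagree : ∀ v ∈ S, v ∉ T → v ≠ v₀ → ∀ c ∈ selmerLocalKer W' (v.adicCompletion K) (p : ℤ),
      h1Equiv θ hθ c ∈ selmerLocalKer W (v.adicCompletion K) (p : ℤ))
    {m : ℕ} (hm : (selmerLocalKer W (v₀.adicCompletion K) (p : ℤ)).relIndex
      ((selmerLocalKer W' (v₀.adicCompletion K) (p : ℤ)).map (h1Equiv θ hθ).toAddMonoidHom) ≤ m)
    (hstrict : ∀ c ∈ selmerLocalKer W' (v₀.adicCompletion K) (p : ℤ),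
      h1Equiv θ hθ c ∈ W.selmerGroup (p : ℤ) → h1Equiv θ hθ c = 0) :
    Nat.card (W'.selmerGroup (p : ℤ)) ≤
      m * ∏ v ∈ T, Nat.card (W'.kummerLocalConditionAt (p : ℤ) (v.adicCompletion K)) := by
  have h := natCard_selmerGroup_le_of_congr_inf W W' hp2 θ hθ S hS v₀
  -- strictness: the first factor is `1`
  have h1 : Nat.card ((W.selmerGroup (p : ℤ)) ⊓
      ((selmerLocalKer W' (v₀.adicCompletion K) (p : ℤ)).map (h1Equiv θ hθ).toAddMonoidHom) :
        AddSubgroup (galH1Torsion W (p : ℤ))) = 1 := by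
    rw [Nat.card_eq_one_iff_unique]
    refine ⟨⟨fun a b ↦ ?_⟩, ⟨⟨0, AddSubgroup.zero_mem _⟩⟩⟩
    have hzero : ∀ d : ((W.selmerGroup (p : ℤ)) ⊓
        ((selmerLocalKer W' (v₀.adicCompletion K) (p : ℤ)).map (h1Equiv θ hθ).toAddMonoidHom) :
          AddSubgroup (galH1Torsion W (p : ℤ))), (d : galH1Torsion W (p : ℤ)) = 0 := by
      intro d
      obtain ⟨hdS, hdm⟩ := AddSubgroup.mem_inf.mp d.2
      obtain ⟨c, hc, hcd⟩ := AddSubgroup.mem_map.mp hdm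
      change h1Equiv θ hθ c = (d : galH1Torsion W (p : ℤ)) at hcd
      rw [← hcd] at hdS ⊢
      exact hstrict c hc hdS
    exact Subtype.ext ((hzero a).trans (hzero b).symm)
  rw [h1, one_mul] at h
  refine h.trans ?_
  -- `∏_{v ∈ S} ι_v = ι_{v₀} · ∏_{v ∈ T} ι_v ≤ m · ∏_{v ∈ T} #𝓛_v`
  have hins : insert v₀ T ⊆ S := Finset.insert_subset hv₀S hTS
  rw [← Finset.prod_sdiff hins, Finset.prod_eq_one (s := S \ insert v₀ T) (fun v hv ↦ ?_), one_mul,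
    Finset.prod_insert hv₀T]
  · exact Nat.mul_le_mul hm
      (Finset.prod_le_prod' fun v _ ↦ (relIndex_map_selmerLocalKer_ne_zero_and_le W W' θ hθ v).2)
  · rw [Finset.mem_sdiff, Finset.mem_insert, not_or] at hv
    exact (relIndex_map_selmerLocalKer_eq_one_iff W W' θ hθ).mpr (hagree v hv.1 hv.2.2 hv.2.1)

end Main

section Rat

variable (W A : WeierstrassCurve ℚ) [W.IsElliptic] [W.IsGloballyMinimal] [A.IsElliptic]
  [A.IsGloballyMinimal] (p : ℕ) [hp : Fact p.Prime]

/-- **The strict count over `ℚ` at the place of `p`, with six kinds of places elsewhere.**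
`θ : E[p] ≃ A[p]` (`E = W`), `p` odd, `S ⊇ T`, `v₀ = (p) ∈ S \ T` with `E` MULTIPLICATIVE and `A` GOOD
at `p` and `A` STRICT at `p` (`hstrict`, file XIX), the places of `S \ (T ∪ {v₀})` of the six kinds
of file XII: `#Sel^(p)(E/ℚ) ≤ p · ∏_{v ∈ T} #E(ℚ_v)[p] · #(ℤ_v/p)` (index `≤ p` at `v₀` by file XIX,
no factor `#Sel^(p)(A)`).
[cite: MazurRubin2004, §2.3] [cite: SilvermanATAEC1994, Ch. V Thm. 3.1, Lemma 5.2, Thm. 5.3, Cor. 5.4, Ex. 5.11]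
[cite: GreenbergLNM1716, §2 Props. 2.2, 2.4] [cite: MilneADT2006, Ch. I §2 Thm. 2.8, Prop. 3.8] -/
theorem natCard_selmerGroup_le_of_six_kinds_strict_at_p_rat
    (hU : Silverman1994_thmV53_tateUniformisation.{0})
    (hU2 : Silverman1994_thmV53_corV54_tateUniformisation.{0})
    (hEP : ∀ v : HeightOneSpectrum (𝓞 ℚ), (p : 𝓞 ℚ) ∈ v.asIdeal →
      localEulerPoincareCharacteristic (v.adicCompletion ℚ)) (hp2 : p ≠ 2)
    (θ : geomTorsion W (p : ℤ) ≃+ geomTorsion A (p : ℤ))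
    (hθ : ∀ (σ : absoluteGaloisGroup ℚ) (P : geomTorsion W (p : ℤ)), θ (σ • P) = σ • θ P)
    (S T : Finset (HeightOneSpectrum (𝓞 ℚ))) (hTS : T ⊆ S)
    (hS : ∀ v : HeightOneSpectrum (𝓞 ℚ), v ∉ S →
      A.HasGoodReductionAt v ∧ W.HasGoodReductionAt v ∧ (p : 𝓞 ℚ) ∉ v.asIdeal)
    {v₀ : HeightOneSpectrum (𝓞 ℚ)} (hpv₀ : (p : 𝓞 ℚ) ∈ v₀.asIdeal) (hv₀S : v₀ ∈ S) (hv₀T : v₀ ∉ T)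
    (hmult : W.HasMultiplicativeReductionAtPrime p) (hA₀ : A.HasGoodReductionAtPrime p)
    (hplaces : ∀ v ∈ S, v ∉ T → v ≠ v₀ →
      ((p : 𝓞 ℚ) ∉ v.asIdeal ∧ Nat.card (nsmulAddMonoidHom p :
          (W.baseChange (v.adicCompletion ℚ)).toAffine.Point →+ _).ker = 1) ∨
      (A.HasSplitMultiplicativeReductionAt v ∧ W.HasSplitMultiplicativeReductionAt v ∧
        Nat.card (nsmulAddMonoidHom p :
          (A.baseChange (v.adicCompletion ℚ)).toAffine.Point →+ _).ker ≤ p) ∨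
      (A.HasMultiplicativeReductionAt v ∧ W.HasMultiplicativeReductionAt v ∧
        (∃ r : v.adicCompletion ℚ, algebraMap ℚ (v.adicCompletion ℚ) (-(A.c₄ / A.c₆)) =
          r ^ 2 * algebraMap ℚ (v.adicCompletion ℚ) (-(W.c₄ / W.c₆))) ∧
        (∀ ζ : v.adicCompletion ℚ, ζ ^ p = 1 → ζ = 1)) ∨
      (∃ (ℓ : ℕ) (_ : Fact ℓ.Prime), ℓ ≠ 2 ∧ (ℓ : 𝓞 ℚ) ∈ v.asIdeal ∧ (p : 𝓞 ℚ) ∉ v.asIdeal ∧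
        W.HasMultiplicativeReductionAtPrime ℓ ∧
        (∀ r : v.adicCompletion ℚ, algebraMap ℚ (v.adicCompletion ℚ) (-(W.c₄ / W.c₆)) ≠ r ^ 2) ∧
        A.HasGoodReductionAt v) ∨
      ((p : 𝓞 ℚ) ∈ v.asIdeal ∧ W.HasMultiplicativeReductionAtPrime p ∧
        (∀ r : v.adicCompletion ℚ, algebraMap ℚ (v.adicCompletion ℚ) (-(W.c₄ / W.c₆)) ≠ r ^ 2) ∧
        A.HasGoodReductionAtPrime p) ∨
      (∃ (ℓ : ℕ) (_ : Fact ℓ.Prime), ℓ ≠ 2 ∧ (ℓ : 𝓞 ℚ) ∈ v.asIdeal ∧ (p : 𝓞 ℚ) ∉ v.asIdeal ∧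
        W.HasGoodReductionAt v ∧ A.HasMultiplicativeReductionAtPrime ℓ ∧
        (∀ r : v.adicCompletion ℚ, algebraMap ℚ (v.adicCompletion ℚ) (-(A.c₄ / A.c₆)) ≠ r ^ 2)))
    {w : Valuation (AlgebraicClosure (v₀.adicCompletion ℚ)) ℝ≥0}
    (hw : ∀ x, (w x : ℝ) =
      spectralNorm (v₀.adicCompletion ℚ) (AlgebraicClosure (v₀.adicCompletion ℚ)) x)
    [hV : (A.baseChange (AlgebraicClosure (v₀.adicCompletion ℚ))).IsIntegral w.integer]
    (hstrict : ∀ ψ : contOneCocycles (discreteTopRep (absoluteGaloisGroup ℚ) (geomTorsion A (p : ℤ))),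
      oneCocycleClass _ ψ ∈ A.selmerGroup (p : ℤ) →
      ∀ b : localPoints A (v₀.adicCompletion ℚ),
        (∀ σ : absoluteGaloisGroup (v₀.adicCompletion ℚ), pointsMap A (v₀.adicCompletion ℚ)
          ((ψ.1 (resGal (K := ℚ) (v₀.adicCompletion ℚ) σ) : geomTorsion A (p : ℤ)) : geomPoints A)
            = σ • b - b) →
        (∀ σ : absoluteGaloisGroup (v₀.adicCompletion ℚ),
          ((σ • b - b : localPoints A (v₀.adicCompletion ℚ)) :
            (A.baseChange (AlgebraicClosure (v₀.adicCompletion ℚ))).toAffine.Point) ∈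
            FormalGroupChart.kernel w (A.baseChange (AlgebraicClosure (v₀.adicCompletion ℚ)))) →
        oneCocycleClass _ ψ = 0) :
    Nat.card (W.selmerGroup (p : ℤ)) ≤
      p * ∏ v ∈ T, (Nat.card (nsmulAddMonoidHom p :
          (W.baseChange (v.adicCompletion ℚ)).toAffine.Point →+ _).ker *
        Nat.card (v.adicCompletionIntegers ℚ ⧸ Ideal.span {(p : v.adicCompletionIntegers ℚ)})) := by
  have hpp : p.Prime := hp.out
  classical
  -- enlarge `T` by the places of kind (i) (they cost `#𝓛_v = 1`)
  set T' := T ∪ S.filter (fun v ↦ (p : 𝓞 ℚ) ∉ v.asIdeal ∧ Nat.card (nsmulAddMonoidHom p :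
      (W.baseChange (v.adicCompletion ℚ)).toAffine.Point →+ _).ker = 1) with hT'
  have hT'S : T' ⊆ S := Finset.union_subset hTS (Finset.filter_subset _ _)
  have hv₀T' : v₀ ∉ T' := by
    rw [hT', Finset.mem_union, Finset.mem_filter, not_or]
    exact ⟨hv₀T, fun h ↦ h.2.1 hpv₀⟩
  have h1 := natCard_selmerGroup_le_of_congr_of_le_off_insert_strict A W hp2 θ hθ S T' hv₀S hv₀T'
    hT'S hS (fun v hv hvT hvv₀ c hc ↦ ?_)
    (relIndex_map_selmerLocalKer_le_of_mult_of_good_at_p W A p hU2 hp2 θ hθ hpv₀ (hEP v₀ hpv₀)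
      hmult hA₀)
    (fun c hc hsel ↦ h1Equiv_eq_zero_of_selmer_of_strict_at_p W A p hU2 hp2 θ hθ hpv₀ hmult hA₀ hw
      hstrict hc hsel)
  · refine h1.trans (le_of_eq ?_)
    congr 1
    have hsplit' : T' = T ∪ (S.filter (fun v ↦ (p : 𝓞 ℚ) ∉ v.asIdeal ∧ Nat.card (nsmulAddMonoidHom p :
      (W.baseChange (v.adicCompletion ℚ)).toAffine.Point →+ _).ker = 1) \ T) := by
      rw [hT', Finset.union_sdiff_self_eq_union]
    rw [hsplit', Finset.prod_union Finset.disjoint_sdiff,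
      Finset.prod_eq_one (s := _ \ T) (fun v hv ↦ ?_), mul_one]
    · refine Finset.prod_congr rfl fun v _ ↦ ?_
      exact W.natCard_kummerLocalConditionAt_adicCompletion v hpp.ne_zero
    · rw [Finset.mem_sdiff, Finset.mem_filter] at hv
      rw [W.natCard_kummerLocalConditionAt_adicCompletion v hpp.ne_zero, hv.1.2.2, one_mul,
        natCard_quot_adicCompletionIntegers_eq_one hv.1.2.1]
  · have hvT0 : v ∉ T := fun h ↦ hvT (Finset.mem_union_left _ h)
    have hnot1 : ¬ ((p : 𝓞 ℚ) ∉ v.asIdeal ∧ Nat.card (nsmulAddMonoidHom p :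
        (W.baseChange (v.adicCompletion ℚ)).toAffine.Point →+ _).ker = 1) := fun h ↦
      hvT (Finset.mem_union_right _ (Finset.mem_filter.mpr ⟨hv, h⟩))
    rcases hplaces v hv hvT0 hvv₀ with h1 | ⟨hWv, hW'v, hcard⟩ | ⟨hWv, hW'v, hγ', hμ⟩ |
        ⟨ℓ, hℓ, hℓ2, hℓv, hpv, hmult', hγ', hAv⟩ | ⟨hpv, hmult', hγ', hAv⟩ |
        ⟨ℓ, hℓ, hℓ2, hℓv, hpv, hWv, hmultA, hγA⟩
    · exact absurd h1 hnot1
    · exact A.h1Equiv_mem_selmerLocalKer_of_hasSplitMultiplicativeReductionAt v hU W θ hθ hWv hW'v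
        hcard hc
    · exact A.h1Equiv_mem_selmerLocalKer_of_hasMultiplicativeReductionAt v hU2 hp2 W θ hθ hWv hW'v
        hγ' hμ hc
    · haveI := hℓ
      exact h1Equiv_mem_selmerLocalKer_of_nonsplit_of_good_rat W A p hU2 hp2 θ hθ hℓ2 hℓv hmult' hγ'
        hAv hpv hc
    · exact h1Equiv_mem_selmerLocalKer_of_nonsplit_of_good_at_p W A p hU2 hp2 θ hθ hpv (hEP v hpv)
        hmult' hγ' hAv hc
    · haveI := hℓ
      exact h1Equiv_mem_selmerLocalKer_of_good_of_nonsplit_rat W A p hU2 hp2 θ hθ hℓ2 hℓv hWv hmultA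
        hγA hpv hc

/-- **Shape E of route (3e) over `ℚ` — `E` multiplicative at `p`, the partner good and STRICT at
`p`.** Let `p` be an odd prime, `E = W` globally minimal of analytic rank `0` with `E[p]`
irreducible and `p ∤ #Ш_an(E)`, MULTIPLICATIVE at `p`; `A` globally minimal, GOOD at `p`, with a
`Γ_ℚ`-isomorphism `e : A[p] ≅ E[p]` (certificate C1); `S ⊇ T` finite sets of places with
`v₀ = (p) ∈ S \ T` and the places of `S \ (T ∪ {v₀})` of the six kinds of file XII; `A` STRICT at
`p` in the sense of file XIX (`hstrict`; for a closed rank-one partner with `Sel^(p)(A) = ⟨κ(g)⟩`: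
the generator's reduction is not divisible by `p` in `Ã(𝔽_p)`). If
`p · ∏_{v∈T} #E(ℚ_v)[p]·#(ℤ_v/p) ≤ p` then `BSD(E,p)`: the strict count gives `#Sel^(p)(E/ℚ) ≤ p`,
Cassels–Tate parity gives `Sel^(p)(E) = 0`, so `Ш(E)[p] = 0`. NO hypothesis `BSD(A,p)`, no rank
condition on `A`, no main conjecture. Binders GZK, Cassels–Tate, A40/A41, Milne I.2.8. Not a class
theorem; nothing booked. [cite: MazurRubin2004, §2.3] [cite: Miller2011LMS, §1 and Def. 1.1]
[cite: SilvermanATAEC1994, Ch. V Thm. 3.1, Lemma 5.2, Thm. 5.3, Cor. 5.4, Ex. 5.11]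
[cite: GreenbergLNM1716, §2 Props. 2.2, 2.4] [cite: MilneADT2006, Ch. I §2 Thm. 2.8, Prop. 3.8] -/
theorem bsdp_of_selmerCompanion_strict_at_p_six_kinds
    (hU : Silverman1994_thmV53_tateUniformisation.{0})
    (hU2 : Silverman1994_thmV53_corV54_tateUniformisation.{0})
    (hEP : ∀ v : HeightOneSpectrum (𝓞 ℚ), (p : 𝓞 ℚ) ∈ v.asIdeal →
      localEulerPoincareCharacteristic (v.adicCompletion ℚ))
    (hGZK : rank_eq_analyticRank_of_analyticRank_le_one)
    (hCT : exists_casselsTate_pairing (K := ℚ)) (hp2 : p ≠ 2)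
    (hr : W.analyticRank = 0) (hirr : Irr W p) (hSha : X11a.ShaAnUnit W p)
    (e : geomTorsion A (p : ℤ) ≃+ geomTorsion W (p : ℤ))
    (he : ∀ (σ : absoluteGaloisGroup ℚ) (P : geomTorsion A (p : ℤ)), e (σ • P) = σ • e P)
    (S T : Finset (HeightOneSpectrum (𝓞 ℚ))) (hTS : T ⊆ S)
    (hS : ∀ v : HeightOneSpectrum (𝓞 ℚ), v ∉ S →
      A.HasGoodReductionAt v ∧ W.HasGoodReductionAt v ∧ (p : 𝓞 ℚ) ∉ v.asIdeal)
    {v₀ : HeightOneSpectrum (𝓞 ℚ)} (hpv₀ : (p : 𝓞 ℚ) ∈ v₀.asIdeal) (hv₀S : v₀ ∈ S) (hv₀T : v₀ ∉ T)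
    (hmult : W.HasMultiplicativeReductionAtPrime p) (hA₀ : A.HasGoodReductionAtPrime p)
    (hplaces : ∀ v ∈ S, v ∉ T → v ≠ v₀ →
      ((p : 𝓞 ℚ) ∉ v.asIdeal ∧ Nat.card (nsmulAddMonoidHom p :
          (W.baseChange (v.adicCompletion ℚ)).toAffine.Point →+ _).ker = 1) ∨
      (A.HasSplitMultiplicativeReductionAt v ∧ W.HasSplitMultiplicativeReductionAt v ∧
        Nat.card (nsmulAddMonoidHom p :
          (A.baseChange (v.adicCompletion ℚ)).toAffine.Point →+ _).ker ≤ p) ∨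
      (A.HasMultiplicativeReductionAt v ∧ W.HasMultiplicativeReductionAt v ∧
        (∃ r : v.adicCompletion ℚ, algebraMap ℚ (v.adicCompletion ℚ) (-(A.c₄ / A.c₆)) =
          r ^ 2 * algebraMap ℚ (v.adicCompletion ℚ) (-(W.c₄ / W.c₆))) ∧
        (∀ ζ : v.adicCompletion ℚ, ζ ^ p = 1 → ζ = 1)) ∨
      (∃ (ℓ : ℕ) (_ : Fact ℓ.Prime), ℓ ≠ 2 ∧ (ℓ : 𝓞 ℚ) ∈ v.asIdeal ∧ (p : 𝓞 ℚ) ∉ v.asIdeal ∧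
        W.HasMultiplicativeReductionAtPrime ℓ ∧
        (∀ r : v.adicCompletion ℚ, algebraMap ℚ (v.adicCompletion ℚ) (-(W.c₄ / W.c₆)) ≠ r ^ 2) ∧
        A.HasGoodReductionAt v) ∨
      ((p : 𝓞 ℚ) ∈ v.asIdeal ∧ W.HasMultiplicativeReductionAtPrime p ∧
        (∀ r : v.adicCompletion ℚ, algebraMap ℚ (v.adicCompletion ℚ) (-(W.c₄ / W.c₆)) ≠ r ^ 2) ∧
        A.HasGoodReductionAtPrime p) ∨
      (∃ (ℓ : ℕ) (_ : Fact ℓ.Prime), ℓ ≠ 2 ∧ (ℓ : 𝓞 ℚ) ∈ v.asIdeal ∧ (p : 𝓞 ℚ) ∉ v.asIdeal ∧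
        W.HasGoodReductionAt v ∧ A.HasMultiplicativeReductionAtPrime ℓ ∧
        (∀ r : v.adicCompletion ℚ, algebraMap ℚ (v.adicCompletion ℚ) (-(A.c₄ / A.c₆)) ≠ r ^ 2)))
    {w : Valuation (AlgebraicClosure (v₀.adicCompletion ℚ)) ℝ≥0}
    (hw : ∀ x, (w x : ℝ) =
      spectralNorm (v₀.adicCompletion ℚ) (AlgebraicClosure (v₀.adicCompletion ℚ)) x)
    [hV : (A.baseChange (AlgebraicClosure (v₀.adicCompletion ℚ))).IsIntegral w.integer]
    (hstrict : ∀ ψ : contOneCocycles (discreteTopRep (absoluteGaloisGroup ℚ) (geomTorsion A (p : ℤ))),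
      oneCocycleClass _ ψ ∈ A.selmerGroup (p : ℤ) →
      ∀ b : localPoints A (v₀.adicCompletion ℚ),
        (∀ σ : absoluteGaloisGroup (v₀.adicCompletion ℚ), pointsMap A (v₀.adicCompletion ℚ)
          ((ψ.1 (resGal (K := ℚ) (v₀.adicCompletion ℚ) σ) : geomTorsion A (p : ℤ)) : geomPoints A)
            = σ • b - b) →
        (∀ σ : absoluteGaloisGroup (v₀.adicCompletion ℚ),
          ((σ • b - b : localPoints A (v₀.adicCompletion ℚ)) :
            (A.baseChange (AlgebraicClosure (v₀.adicCompletion ℚ))).toAffine.Point) ∈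
            FormalGroupChart.kernel w (A.baseChange (AlgebraicClosure (v₀.adicCompletion ℚ)))) →
        oneCocycleClass _ ψ = 0)
    (hbudget : p * ∏ v ∈ T, (Nat.card (nsmulAddMonoidHom p :
        (W.baseChange (v.adicCompletion ℚ)).toAffine.Point →+ _).ker *
          Nat.card (v.adicCompletionIntegers ℚ ⧸
            Ideal.span {(p : v.adicCompletionIntegers ℚ)})) ≤ p) :
    BSDp W p := by
  have hθ : ∀ (σ : absoluteGaloisGroup ℚ) (Q : geomTorsion W (p : ℤ)),
      e.symm (σ • Q) = σ • e.symm Q := fun σ Q ↦ by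
    apply e.injective
    rw [e.apply_symm_apply, he, e.apply_symm_apply]
  have hle := natCard_selmerGroup_le_of_six_kinds_strict_at_p_rat W A p hU hU2 hEP hp2 e.symm hθ
    S T hTS hS hpv₀ hv₀S hv₀T hmult hA₀ hplaces hw hstrict
  exact bsdp_of_natCard_selmerGroup_le W p hGZK hCT hr hirr hSha (hle.trans hbudget)

end Rat

end Summit.BirchSwinnertonDyer.Rank1Residual.X11a.SelmerCompanion

end
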